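import Summits.QuantumFields.YangMills.Theorems.BalabanUVNodesPortS1JacIntLocal
import Summits.QuantumFields.YangMills.Theorems.BalabanUVNodesPortS1LocalFormula
import Summits.QuantumFields.YangMills.Theorems.BalabanUVNodesPortHRecordRowG

/-!
# NODE O port PT-A — ROW (e) OF `stub_LZjac`: THE LOCALIZATION DOMAIN `X(c)` OF A COARSE BOND — on the exactly tiled range `X(c)` is the pair of wall-adjacent `Mc`-cubes of `c₋, c₊`
# (`domOfBond_val`), `d_{k+1}(X(c)) ≤ 1`, and THE WINDOW OF `c` COVERS INTO THE SITES OF `X(c)` (`cover_mem_domSites_domOfBond`)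

Cell `ym-nodeO-ideate`, porter seat `ymgap-nodeO-port-PTA-1` (gen 6); `--supports stmt-QuantumFields-27930` (helper); objects ✓ `…PortS1JacPiecesDefs`; tiling ✓ `…K0RecordFormatNamesLemmas`
(`domCount_mul_side_eq`), ✓ `…PortS1LocalFormula` §1.  [I] = [Balaban1987RG1].  Print: p.257 (the cubes π_j, «two consecutive cubes have a common wall», d_j(X)), (1.7) p.261.
* §1 (`N_{k+1} = q·Mc` is ✓ `PortHRecordRowG.sitesPerDir_eq_domCount_mul`, reused) `val_div_lt_domCount`, `val_cubeOfSite`, ★ `cubeOfSite_tgt` (the cube of `c₊` is that of `c₋` or its `+e_μ` wall-neighbour, wrap-around included).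
* §2 `isTDom_pair`, ★ `domOfBond_val`, `cubeOfSite_src_mem_domOfBond`, `card_domOfBond_le_two`, ★ `dj_domOfBond_le_one`.
* §3 `cover_mem_cubeEnl_of_blockMap_cast_eq` (deck translation `q·s = N`), `cover_mem_domSites_of_blockMap`, ★★ `cover_mem_domSites_domOfBond`.

HONEST FRAMING.  Torus ∕ integer bookkeeping; NOTHING of Bałaban's estimates asserted, ported or discharged; `stub_LZjac` OPEN; 27930 OPEN · no claim; K0⁷∕K-Ax OPEN; NODE O 0∕1; COUNT 8∕28 ·
K 1∕4 UNMOVED; finite `𝕋⁴_{L^K}` at fixed ε — NOT continuum ∕ OS ∕ Clay; **the Yang–Mills mass gap is NOT proved by any of this.**  No `sorry`, no `def`, no `instance`, no `notation`; standard axioms.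
-/

noncomputable section

open scoped BigOperators Matrix.Norms.L2Operator Topology

namespace Summit.QuantumFields.YangMills.Theorems.BalabanUVNodesPortS1

open Summit.QuantumFields.YangMills.Theorems.K0RecordFormatNames
open Literature.MathematicalPhysics.QuantumFieldTheory.Balaban1983to89
open Literature.MathematicalPhysics.QuantumFieldTheory.Balaban1983to89.Node00
open Literature.MathematicalPhysics.QuantumFieldTheory.Balaban1983to89.T4Continuum (T4Family Letter LStep)
open Literature.MathematicalPhysics.QuantumFieldTheory.Balaban1983to89.B7Prop1Explicit (e e_apply)
open Literature.MathematicalPhysics.QuantumFieldTheory.Balaban1983to89.BlockAveragingZd (IdxZ offZ)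
open Literature.MathematicalPhysics.QuantumFieldTheory.Balaban1983to89.B15Eq112TorusCover (cover)
open Literature.MathematicalPhysics.QuantumFieldTheory.Balaban1983to89.B14.Eq213MaximalDomains (cubeExt side)
open Literature.MathematicalPhysics.QuantumFieldTheory.Balaban1983to89.TreeLengthTorus (TPt IsTDom)
open Literature.MathematicalPhysics.QuantumLattice (blockMap blockSites mem_blockSites_iff)
open _root_.Matrix

/-! ## §1  The exactly tiled range: `N_{k+1} = q · Mc`, the cube index of a level-`(k+1)` site -/

section Tiled

variable (F : T4Family)

variable {F} in
/-- The cube index coordinate of a level-`(k+1)` site is below `q`. [cite: Balaban1987RG1, p.257 (bookkeeping)] -/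
theorem val_div_lt_domCount {Mc k K : ℕ} (hMc : McGuard F Mc) (hK : recordK₀ F Mc k ≤ K) (y : Site (F.P K) (k + 1)) (i : Fin (F.P K).d) :
    (y i).val / Mc < Sect2.domCount (F.P K) Mc (k + 1) := by
  have hMc0 : 0 < Mc := by obtain ⟨c, rfl⟩ := hMc; exact pow_pos (by have := F.hL.2; omega) _
  have hy : (y i).val < Sect2.domCount (F.P K) Mc (k + 1) * Mc := ((y i).val_lt).trans_eq (PortHRecordRowG.sitesPerDir_eq_domCount_mul hMc hK)
  exact (Nat.div_lt_iff_lt_mul hMc0).2 hy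

variable {F} in
/-- `(cubeOfSite y i).val = (y i).val ∕ Mc` on the tiled range. [cite: Balaban1987RG1, p.257 (bookkeeping)] -/
theorem val_cubeOfSite {Mc k K : ℕ} (hMc : McGuard F Mc) (hK : recordK₀ F Mc k ≤ K) (y : Site (F.P K) (k + 1)) (i : Fin (F.P K).d) :
    (cubeOfSite F Mc k K y i).val = (y i).val / Mc := by
  unfold cubeOfSite
  rw [ZMod.val_natCast, Nat.mod_eq_of_lt (val_div_lt_domCount hMc hK y i)]

variable {F} in
/-- **The cube of `c₊` is the cube of `c₋` or its wall-neighbour `+e_μ`** (tiled range; the wrap-around case `(q − 1) + 1 = 0` included). [cite: Balaban1987RG1, p.257 («two consecutive cubes have a common wall»)] -/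
theorem cubeOfSite_tgt {Mc k K : ℕ} (hMc : McGuard F Mc) (hK : recordK₀ F Mc k ≤ K) (c : PBond (F.P K) (k + 1)) :
    cubeOfSite F Mc k K c.tgt = cubeOfSite F Mc k K c.src ∨
      cubeOfSite F Mc k K c.tgt = Function.update (cubeOfSite F Mc k K c.src) c.dir (cubeOfSite F Mc k K c.src c.dir + 1) := by
  have hMc0 : 0 < Mc := by obtain ⟨c, rfl⟩ := hMc; exact pow_pos (by have := F.hL.2; omega) _
  have hN := PortHRecordRowG.sitesPerDir_eq_domCount_mul hMc hK
  set q := Sect2.domCount (F.P K) Mc (k + 1) with hq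
  have hq1 : 1 ≤ q := by rw [hq]; exact Nat.succ_le_of_lt (Nat.succ_pos _)
  set v : ℕ := (c.src c.dir).val with hv
  have hvlt : v < q * Mc := ((c.src c.dir).val_lt).trans_eq hN
  -- the target differs from the source only in direction `c.dir`
  have hoff : ∀ i, i ≠ c.dir → cubeOfSite F Mc k K c.tgt i = cubeOfSite F Mc k K c.src i := by
    intro i hi
    simp only [cubeOfSite, PBond.tgt, Site.shift, Function.update_of_ne hi]
  -- the value of the target coordinate
  have htgt : (c.tgt c.dir).val = (v + 1) % ((F.P K).sitesPerDir (k + 1)) := by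
    simp only [PBond.tgt, Site.shift, Function.update_self]
    rw [ZMod.val_add, ← hv, ZMod.val_one]
  by_cases hlt : v + 1 < q * Mc
  · -- no wrap-around: the target value is `v + 1`
    have htgt' : (c.tgt c.dir).val = v + 1 := by
      rw [htgt, Nat.mod_eq_of_lt]; rw [hN]; exact hlt
    by_cases hcase : (v + 1) / Mc = v / Mc
    · left
      funext i
      by_cases hi : i = c.dir
      · subst hi
        simp only [cubeOfSite]
        rw [htgt', ← hv, hcase]
      · exact hoff i hi
    · right
      funext i
      by_cases hi : i = c.dir
      · subst hi
        rw [Function.update_self]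
        simp only [cubeOfSite]
        rw [htgt', ← hv]
        have h1 : (v + 1) / Mc = v / Mc + 1 := by
          have h2 : (v + 1) / Mc ≤ v / Mc + 1 := by
            rw [Nat.div_le_iff_le_mul_add_pred hMc0]
            have := Nat.lt_div_mul_add hMc0 (a := v)
            have h3 := Nat.div_add_mod v Mc
            have h4 := Nat.mod_lt v hMc0
            nlinarith
          have h3 : v / Mc ≤ (v + 1) / Mc := Nat.div_le_div_right (Nat.le_succ v)
          omega
        rw [h1]; push_cast; rfl
      · rw [Function.update_of_ne hi]
        exact hoff i hi
  · -- wrap-around: `v + 1 = q·Mc`, the target value is `0`, the source cube index is `q − 1`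
    have heq : v + 1 = q * Mc := by omega
    have htgt' : (c.tgt c.dir).val = 0 := by rw [htgt, hN, heq, Nat.mod_self]
    right
    funext i
    by_cases hi : i = c.dir
    · subst hi
      rw [Function.update_self]
      simp only [cubeOfSite]
      rw [htgt', ← hv, Nat.zero_div]
      have h2 : v / Mc = q - 1 := by
        have h3 : v = (Mc - 1) + (q - 1) * Mc := by
          zify [hq1, hMc0] at heq ⊢
          linear_combination heq
        rw [h3, Nat.add_mul_div_right _ _ hMc0, Nat.div_eq_of_lt (Nat.sub_lt hMc0 Nat.one_pos), zero_add]
      rw [h2, Nat.cast_sub hq1, Nat.cast_one, sub_add_cancel, ZMod.natCast_self, Nat.cast_zero]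
    · rw [Function.update_of_ne hi]
      exact hoff i hi

end Tiled

/-! ## §2  `X(c)` is a localization domain of one or two wall-adjacent cubes; its linear size is at most one -/

section Dom

variable (F : T4Family)

/-- A pair `{a, b}` with `b = a` or `b = a + e_i` is a non-empty wall-connected family. [cite: Balaban1987RG1, p.257 (localization domains)] -/
theorem isTDom_pair {d N : ℕ} {a b : TPt d N} (h : b = a ∨ ∃ i, b = Function.update a i (a i + 1)) : IsTDom ({a, b} : Finset (TPt d N)) := by
  classical
  refine ⟨⟨a, by simp⟩, fun x hx y hy => ?_⟩
  rcases h with rfl | ⟨i, rfl⟩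
  · simp only [Finset.mem_insert, Finset.mem_singleton, or_self] at hx hy
    subst hx; subst hy
    exact Relation.ReflTransGen.refl
  · have hab : TreeLengthTorus.TAdj a (Function.update a i (a i + 1)) := TreeLengthTorus.tadj_update_add_one a i
    have hmem_a : a ∈ ({a, Function.update a i (a i + 1)} : Finset (TPt d N)) := by simp
    have hmem_b : Function.update a i (a i + 1) ∈ ({a, Function.update a i (a i + 1)} : Finset (TPt d N)) := by simp
    simp only [Finset.mem_insert, Finset.mem_singleton] at hx hy
    rcases hx with rfl | rfl <;> rcases hy with rfl | rfl
    · exact Relation.ReflTransGen.refl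
    · exact Relation.ReflTransGen.single ⟨hmem_a, hmem_b, hab⟩
    · exact Relation.ReflTransGen.single ⟨hmem_b, hmem_a, hab.symm⟩
    · exact Relation.ReflTransGen.refl

variable {F} in
/-- ★ **`X(c)` IS the pair of cubes of `c₋, c₊`** on the tiled range (the `dite` of `domOfBond` takes its first branch). [cite: Balaban1987RG1, p.257, (1.7) p.261] -/
theorem domOfBond_val {Mc k K : ℕ} (hMc : McGuard F Mc) (hK : recordK₀ F Mc k ≤ K) (c : PBond (F.P K) (k + 1)) :
    (domOfBond F Mc k K c).1 = {cubeOfSite F Mc k K c.src, cubeOfSite F Mc k K c.tgt} := by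
  classical
  have h : IsTDom ({cubeOfSite F Mc k K c.src, cubeOfSite F Mc k K c.tgt} : Finset (TPt (F.P K).d (Sect2.domCount (F.P K) Mc (k + 1)))) := by
    refine isTDom_pair ?_
    rcases cubeOfSite_tgt hMc hK c with h | h
    · exact Or.inl h
    · exact Or.inr ⟨c.dir, h⟩
  unfold domOfBond
  rw [dif_pos h]

/-- The cube of `c₋` belongs to `X(c)` (any range: in the default branch `X(c)` is that single cube). [cite: Balaban1987RG1, p.257 (bookkeeping)] -/
theorem cubeOfSite_src_mem_domOfBond (Mc k K : ℕ) (c : PBond (F.P K) (k + 1)) : cubeOfSite F Mc k K c.src ∈ (domOfBond F Mc k K c).1 := by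
  classical
  unfold domOfBond
  split_ifs with h
  · exact Finset.mem_insert_self _ _
  · exact Finset.mem_singleton_self _

/-- `X(c)` has at most two cubes. [cite: Balaban1987RG1, p.257 (bookkeeping)] -/
theorem card_domOfBond_le_two (Mc k K : ℕ) (c : PBond (F.P K) (k + 1)) : (domOfBond F Mc k K c).1.card ≤ 2 := by
  classical
  unfold domOfBond
  split_ifs with h
  · exact (Finset.card_insert_le _ _).trans (by rw [Finset.card_singleton])
  · show ({cubeOfSite F Mc k K c.src} : Finset _).card ≤ 2
    rw [Finset.card_singleton]; norm_num

/-- ★ **`d_{k+1}(X(c)) ≤ 1`**: the linear size of a one- or two-cube domain is at most one (`torusTreeLen ≤ #cubes − 1`). [cite: Balaban1987RG1, p.257 (d_j(X)); Balaban1988RG2Cluster, (2.30) p.18] -/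
theorem dj_domOfBond_le_one (Mc k K : ℕ) (c : PBond (F.P K) (k + 1)) : (recordDomSys F Mc k K).dj (domOfBond F Mc k K c) ≤ 1 := by
  have h := TreeLengthTorus.torusTreeLen_le_card_sub_one (domOfBond F Mc k K c).2.1 (domOfBond F Mc k K c).2.2
  have hc : ((domOfBond F Mc k K c).1.card : ℝ) ≤ 2 := by exact_mod_cast card_domOfBond_le_two F Mc k K c
  show TreeLengthTorus.torusTreeLen (domOfBond F Mc k K c).1 ≤ 1
  linarith

end Dom

/-! ## §3  The window of `c` covers into the sites of `X(c)` -/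

section Sites

variable (F : T4Family)

variable {F} in
/-- **A fine integer point whose `s`-block index is congruent (mod `q`) to a cube index `a` covers into the torus cube of `a`** (shift by a deck translation: `q · s = N`).
[cite: Balaban1987RG1, p.257, (1.21) p.264 (bookkeeping)] -/
theorem cover_mem_cubeEnl_of_blockMap_cast_eq {Mc k K : ℕ} (hMc : McGuard F Mc) (hK : recordK₀ F Mc k ≤ K) {z : Fin (F.P K).d → ℤ}
    {a : TPt (F.P K).d (Sect2.domCount (F.P K) Mc (k + 1))} (h : ∀ i, ((blockMap (F.L ^ (k + 1) * Mc) z i : ℤ) : ZMod (Sect2.domCount (F.P K) Mc (k + 1))) = a i) :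
    cover (F.P K) z ∈ cubeEnl (F.P K) (F.L ^ (k + 1) * Mc) (Sect2.liftIdx (F.P K) a) 0 := by
  have hs : 0 < F.L ^ (k + 1) * Mc := side_record_pos F hMc k
  set s := F.L ^ (k + 1) * Mc with hsdef
  set w : Fin (F.P K).d → ℤ := z + fun i => (s : ℤ) * (((a i).val : ℤ) - blockMap s z i) with hw
  have hdvd : ∀ i, ((Sect2.domCount (F.P K) Mc (k + 1) : ℕ) : ℤ) ∣ ((a i).val : ℤ) - blockMap s z i := by
    intro i
    rw [← ZMod.intCast_eq_intCast_iff_dvd_sub, h i, Int.cast_natCast, ZMod.natCast_zmod_val]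
  have hcov : cover (F.P K) w = cover (F.P K) z := by
    funext i
    have hN : (((F.P K).sitesPerDir 0 : ℕ) : ℤ) ∣ (s : ℤ) * (((a i).val : ℤ) - blockMap s z i) := by
      rw [sitesPerDir_eq_domCount_mul_side_int hMc hK, mul_comm]
      exact mul_dvd_mul_left _ (hdvd i)
    show (((z + fun i => (s : ℤ) * (((a i).val : ℤ) - blockMap s z i)) i : ℤ) : ZMod ((F.P K).sitesPerDir 0)) = ((z i : ℤ) : ZMod ((F.P K).sitesPerDir 0))
    rw [Pi.add_apply, Int.cast_add, (ZMod.intCast_zmod_eq_zero_iff_dvd _ _).2 hN, add_zero]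
  have hblk : blockMap s w = Sect2.liftIdx (F.P K) a := by
    funext i
    show (z + fun i => (s : ℤ) * (((a i).val : ℤ) - blockMap s z i)) i / (s : ℤ) = ((a i).val : ℤ)
    rw [Pi.add_apply, Int.add_mul_ediv_left _ _ (by exact_mod_cast hs.ne')]
    simp only [blockMap]
    ring
  rw [← hcov]
  refine ⟨w, ?_, rfl⟩
  rw [Nat.zero_mul, Nat.cast_zero, ← hblk]
  exact mem_cubeExt_blockMap hs w

variable {F} in
/-- **If the `(k+1)`-block of a fine integer point covers the level-`(k+1)` site `y`, the point covers into the cube of `y`** — hence into the sites of every domain containing that cube.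
[cite: Balaban1987RG1, p.257, (1.7) p.261, (1.21) p.264] -/
theorem cover_mem_domSites_of_blockMap {Mc k K : ℕ} (hMc : McGuard F Mc) (hK : recordK₀ F Mc k ≤ K) (X : (recordDomSys F Mc k K).Dom)
    {z : Fin (F.P K).d → ℤ} {y : Site (F.P K) (k + 1)} (hz : coverAt (F.P K) (k + 1) (blockMap (F.L ^ (k + 1)) z) = y) (hy : cubeOfSite F Mc k K y ∈ X.1) :
    cover (F.P K) z ∈ Sect2.domSites (F.P K) Mc (k + 1) X := by
  have hMc0 : 0 < Mc := by obtain ⟨c, rfl⟩ := hMc; exact pow_pos (by have := F.hL.2; omega) _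
  have hN := PortHRecordRowG.sitesPerDir_eq_domCount_mul hMc hK
  rw [Sect2.domSites, Set.mem_iUnion₂]
  refine ⟨cubeOfSite F Mc k K y, hy, ?_⟩
  show cover (F.P K) z ∈ cubeEnl (F.P K) (side (F.P K).L Mc (k + 1)) (Sect2.liftIdx (F.P K) (cubeOfSite F Mc k K y)) 0
  rw [show side (F.P K).L Mc (k + 1) = F.L ^ (k + 1) * Mc from rfl]
  refine cover_mem_cubeEnl_of_blockMap_cast_eq hMc hK fun i => ?_
  -- `⌊z ∕ (L^{k+1} Mc)⌋ = ⌊ŷ ∕ Mc⌋` with `ŷ = ⌊z ∕ L^{k+1}⌋ ≡ val (y i)  (mod q·Mc)`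
  have hyi : ((blockMap (F.L ^ (k + 1)) z i : ℤ) : ZMod ((F.P K).sitesPerDir (k + 1))) = y i := by
    have := congrFun hz i; simpa [coverAt_apply] using this
  obtain ⟨t, ht⟩ : ∃ t : ℤ, blockMap (F.L ^ (k + 1)) z i = ((y i).val : ℤ) + ((Sect2.domCount (F.P K) Mc (k + 1) * Mc : ℕ) : ℤ) * t := by
    have h1 : ((blockMap (F.L ^ (k + 1)) z i : ℤ) : ZMod ((F.P K).sitesPerDir (k + 1))) = (((y i).val : ℤ) : ZMod _) := by
      rw [hyi, Int.cast_natCast, ZMod.natCast_zmod_val]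
    obtain ⟨t, ht⟩ := (ZMod.intCast_eq_intCast_iff_dvd_sub _ _ _).1 h1.symm
    have hcast : (((F.P K).sitesPerDir (k + 1) : ℕ) : ℤ) = ((Sect2.domCount (F.P K) Mc (k + 1) * Mc : ℕ) : ℤ) := congrArg Nat.cast hN
    exact ⟨t, by linear_combination ht + t * hcast⟩
  have hdiv : blockMap (F.L ^ (k + 1) * Mc) z i = (((y i).val / Mc : ℕ) : ℤ) + (Sect2.domCount (F.P K) Mc (k + 1) : ℤ) * t := by
    have e1 : blockMap (F.L ^ (k + 1) * Mc) z i = blockMap (F.L ^ (k + 1)) z i / (Mc : ℤ) := by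
      simp only [blockMap]
      rw [Nat.cast_mul, Nat.cast_pow, Int.ediv_ediv_of_nonneg (by positivity)]
    rw [e1, ht, Nat.cast_mul, show ((y i).val : ℤ) + (Sect2.domCount (F.P K) Mc (k + 1) : ℤ) * (Mc : ℤ) * t =
      ((y i).val : ℤ) + (Mc : ℤ) * ((Sect2.domCount (F.P K) Mc (k + 1) : ℤ) * t) by ring,
      Int.add_mul_ediv_left _ _ (by exact_mod_cast hMc0.ne'), Int.natCast_div]
  show _ = (((y i).val / Mc : ℕ) : ZMod (Sect2.domCount (F.P K) Mc (k + 1)))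
  rw [hdiv, Int.cast_add, Int.cast_mul, Int.cast_natCast, Int.cast_natCast, ZMod.natCast_self, zero_mul, add_zero]

variable {F} in
/-- ★ **THE WINDOW OF `c` COVERS INTO THE SITES OF `X(c)`**: a fine integer point whose `(k+1)`-block index is the lift of `c₋`, or that lift `+ e_μ`, covers into `Sect2.domSites (X(c))`.
[cite: Balaban1987RG1, (1.7) p.261, p.257, p.267] -/
theorem cover_mem_domSites_domOfBond {Mc k K : ℕ} (hMc : McGuard F Mc) (hK : recordK₀ F Mc k ≤ K) (c : PBond (F.P K) (k + 1)) {z : Fin (F.P K).d → ℤ}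
    (hz : blockMap (F.L ^ (k + 1)) z ∈ ({(fun i => ((c.src i).val : ℤ)), (fun i => ((c.src i).val : ℤ)) + e c.dir} : Set (Fin (F.P K).d → ℤ))) :
    cover (F.P K) z ∈ Sect2.domSites (F.P K) Mc (k + 1) (domOfBond F Mc k K c) := by
  rcases hz with h | h
  · refine cover_mem_domSites_of_blockMap hMc hK _ (y := c.src) ?_ ?_
    · rw [h]; exact coverAt_valLift (k + 1) c.src
    · rw [domOfBond_val hMc hK]; exact Finset.mem_insert_self _ _
  · rw [Set.mem_singleton_iff] at h
    refine cover_mem_domSites_of_blockMap hMc hK _ (y := c.tgt) ?_ ?_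
    · rw [h, coverAt_add_e, coverAt_valLift]; rfl
    · rw [domOfBond_val hMc hK]; exact Finset.mem_insert_of_mem (Finset.mem_singleton_self _)

end Sites

end Summit.QuantumFields.YangMills.Theorems.BalabanUVNodesPortS1

end
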